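import Summits.RiemannHypothesis.RiemannHypothesis.Theorems.TiltedLandingLaw421R3GenusOneLogDeriv2
import Literature.Barriers.RiemannHypothesis.EpsteinZetaStark
import Literature.NumberTheory.LFunctions.NymanBeurlingVectorsOrthogonal

/-!
# Genus-one log-derivative (3/3): the two-point bound for the cofactor at a simple zero

Everything here is PROVED (standard axioms). AI-produced formalisation (planner-rh-idea-3-g41-0, W-08 cell C3 «analysis»,
2026-08-30; helper toward crux 33346 `TiltedLandingLaw421R` — the Newton door of `RhW08.NewtonDoor`; nothing here bears on the
truth of RH, RH is not proved); AI review is weaker than expert review.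

★ `twoPoint_bound_dslope` (socket S1 `CofactorTwoPointSig` of the NewtonDoor endgame map, in the exact shape consumed by
`RhW08.NewtonDoor.succ_of_newton_door_twoPointU`): `F` entire, `‖F z‖ ≤ C e^{‖z‖^ρ}` with ANY `ρ < 2` (no sign
condition, no `F 0 ≠ 0`), `v` a simple zero (`analyticOrderAt F v = 1`), `h := dslope F v`. There are an index type `ι`,
points `a : ι → ℂ` (the zeros of `F` off `v`) and weights `m ≡ 1` with: `{i | a i = c}.ncard = analyticOrderNatAt h c` for
every `c`; every list-sum `Σ_i m_i g(a_i)` is the multiplicity-weighted sum over the zeros of `h` (`HasSum`); every zero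
of `h` is listed; `Σ_i m_i/((‖v − a_i‖ − r)‖v − a_i‖) < ∞` when the list is `r`-separated from `v`; and for any two
non-zeros `z, w` of `h`: `‖h'(z)/h(z) − h'(w)/h(w)‖ ≤ ‖z − w‖ · Σ_i m_i/(‖z − a_i‖ ‖w − a_i‖)` (summable). Proof:
Hadamard genus one (tree `hadamard_genus_one_zeros`) for the translate `x ↦ h (x + v)` (`h v = F'(v) ≠ 0`) after exponent
normalisation and bump (part 2). [cite: Conway1978, Ch. XI Thm. 3.4] [cite: Boas1954, §2.7, §2.10]

## References
* R. P. Boas, *Entire Functions*, Academic Press 1954, §2.7 (Hadamard factorisation), §2.10 (genus; order `< 2` ⇒ `Σ |aₙ|⁻² < ∞`).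
* J. B. Conway, *Functions of One Complex Variable I*, GTM 11, Ch. XI Thm. 3.4 (Hadamard).
* B. Ya. Levin, *Lectures on Entire Functions*, AMS 1996, Lectures 4–5.
-/

noncomputable section

open Complex Filter Topology Set

namespace Literature.Analysis.Complex

namespace GenusOneLogDerivC3g41

/-- (K) alias for the Literature decl. -/
private abbrev differentiable_dslope_of_differentiable := @Literature.NumberTheory.LFunctions.BurnolVectors.differentiable_dslope

/-- (K) alias for the Literature decl. -/
private abbrev deriv_ne_zero_of_analyticOrderAt_eq_one := @Literature.Barriers.RiemannHypothesis.deriv_ne_zero_of_analyticOrderAt_eq_one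

/-- **C1 g28's exact target (RIDER-16 ASK, `twoPoint_bound_dslope`) + the zero-list clause of RIDER-17.**
`F` entire with `‖F z‖ ≤ C e^{‖z‖^ρ}`, `ρ < 2`, `v` a simple zero. Then there are an index type `ι`, zeros
`a : ι → ℂ` of `F` off `v` (each zero `a` of the cofactor `h = dslope F v` listed exactly `analyticOrderNatAt h a`
times — exported as `{i | a i = c}.ncard = analyticOrderNatAt h c` for EVERY `c`; every zero of `h` is listed) and
weights `m = 1` (exported) such that (END input) `Σ_i m_i/((‖v − a_i‖ − r)‖v − a_i‖) < ∞`
whenever all listed zeros are farther than `r ≥ 0` from `v`, and for any two non-zeros `z, w` of `h`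
`‖h'(z)/h(z) − h'(w)/h(w)‖ ≤ ‖z − w‖ · Σ' i, m i/(‖z − a i‖ ‖w − a i‖)`. No `F 0 ≠ 0`, no sign condition on `ρ`:
Hadamard genus one is applied to `x ↦ h (x + v)` (non-zero at `0` since `h v = F'(v) ≠ 0`), after the exponent is
normalised to `max ρ 0` and bumped to `(max ρ 0 + 2)/2 < 2` to absorb the translation. -/
theorem twoPoint_bound_dslope {F : ℂ → ℂ} {C ρ : ℝ} (hF : Differentiable ℂ F)
    (hgrowth : ∀ z, ‖F z‖ ≤ C * Real.exp (‖z‖ ^ ρ)) (hρ : ρ < 2) {v : ℂ} (hv : F v = 0)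
    (hsimple : analyticOrderAt F v = 1) :
    ∃ (ι : Type) (a : ι → ℂ) (m : ι → ℝ), (∀ i, 0 ≤ m i) ∧ (∀ i, F (a i) = 0 ∧ a i ≠ v) ∧
      (∀ i, m i = 1) ∧ (∀ c : ℂ, {i | a i = c}.ncard = analyticOrderNatAt (dslope F v) c) ∧
      (∀ g : ℂ → ℝ, Summable (fun i ↦ m i * g (a i)) →
        HasSum (fun c : ℂ ↦ (analyticOrderNatAt (dslope F v) c : ℝ) * g c) (∑' i, m i * g (a i))) ∧
      (∀ z, dslope F v z = 0 → ∃ i, z = a i ∧ 0 < m i) ∧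
      (∀ r : ℝ, 0 ≤ r → (∀ i, r < ‖v - a i‖) →
        Summable (fun i ↦ m i / ((‖v - a i‖ - r) * ‖v - a i‖))) ∧
      ∀ z w, dslope F v z ≠ 0 → dslope F v w ≠ 0 →
        Summable (fun i ↦ m i / (‖z - a i‖ * ‖w - a i‖)) ∧
        ‖deriv (dslope F v) z / dslope F v z - deriv (dslope F v) w / dslope F v w‖ ≤
          ‖z - w‖ * ∑' i, m i / (‖z - a i‖ * ‖w - a i‖) := by
  -- the cofactor and its translate
  set h : ℂ → ℂ := dslope F v with hh
  have hhd : Differentiable ℂ h := differentiable_dslope_of_differentiable hF v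
  have hhv : h v ≠ 0 := by
    rw [hh, dslope_same]
    exact deriv_ne_zero_of_analyticOrderAt_eq_one (hF.analyticAt v) hsimple
  have hval : ∀ w : ℂ, w ≠ v → h w = F w / (w - v) := by
    intro w hw
    rw [hh, dslope_of_ne _ hw, slope_def_field, hv, sub_zero]
  -- growth of `h`, exponent `σ = max ρ 0`
  obtain ⟨C₁, hC₁, hg₁⟩ := growth_nonneg_exponent hF hgrowth
  set σ : ℝ := max ρ 0 with hσ
  have hσ0 : 0 ≤ σ := le_max_right _ _
  have hσ2 : σ < 2 := max_lt hρ (by norm_num)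
  have hgh : ∀ z, ‖h z‖ ≤ (C₁ * Real.exp ((‖v‖ + 1) ^ σ)) * Real.exp (‖z‖ ^ σ) :=
    fun z ↦ norm_dslope_le hF hσ0 hg₁ hv z
  set G : ℂ → ℂ := fun x ↦ h (x + v) with hGdef
  have hGd : Differentiable ℂ G := hhd.comp (differentiable_id.add_const v)
  set σ' : ℝ := (σ + 2) / 2 with hσ'
  have hσσ' : σ < σ' := by rw [hσ']; linarith
  have hσ'2 : σ' < 2 := by rw [hσ']; linarith
  obtain ⟨C₂, hg₂⟩ := growth_translate hσ0 (by positivity) hgh v hσσ'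
  have hG0 : G 0 ≠ 0 := by simpa [hGdef] using hhv
  obtain ⟨b, hb, hzero, hmult, hprod⟩ := hadamard_genus_one_zeros G σ' C₂ hGd hσ'2 hg₂ hG0
  -- multiplicities: each `c` is listed exactly `analyticOrderNatAt h c` times (translation-invariance
  -- of the order + `hmult`; for `c = v` both sides are `0`)
  have hcard : ∀ c : ℂ, ({i : {n : ℕ // b n ≠ 0} | v + (b i.1)⁻¹ = c} : Set _).ncard =
      analyticOrderNatAt h c := by
    intro c
    have hcomp : analyticOrderNatAt G (c - v) = analyticOrderNatAt h c := by
      unfold analyticOrderNatAt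
      congr 1
      have hG' : G = h ∘ (fun x ↦ x + v) := rfl
      rw [hG', analyticOrderAt_comp_of_deriv_ne_zero (by fun_prop) (by simp), sub_add_cancel]
    rw [show ({i : {n : ℕ // b n ≠ 0} | v + (b i.1)⁻¹ = c} : Set _) =
        {i : {n : ℕ // b n ≠ 0} | (i : ℕ) ∈ {n : ℕ | v + (b n)⁻¹ = c}} from rfl,
      Set.ncard_subtype, ← hcomp]
    by_cases hcv : c = v
    · rw [hcv, sub_self]
      have hempty : ({n : ℕ | v + (b n)⁻¹ = v} ∩ setOf fun n ↦ b n ≠ 0) = ∅ := by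
        ext n
        simp
      rw [hempty, Set.ncard_empty]
      unfold analyticOrderNatAt
      rw [((hGd.analyticAt 0).analyticOrderAt_eq_zero).2 hG0]
      simp
    · have hα : c - v ≠ 0 := sub_ne_zero.2 hcv
      rw [← hmult (c - v) hα]
      congr 1
      ext n
      simp only [Set.mem_inter_iff, Set.mem_setOf_eq]
      constructor
      · rintro ⟨h1, -⟩
        have h2 : (b n)⁻¹ = c - v := by rw [← h1]; ring
        rw [← h2, inv_inv]
      · intro h1
        refine ⟨?_, ?_⟩
        · rw [h1, inv_inv]
          ring
        · rw [h1]
          exact inv_ne_zero hα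
  -- the index type: genuine inverse zeros
  refine ⟨{n : ℕ // b n ≠ 0}, fun i ↦ v + (b i.1)⁻¹, fun _ ↦ 1, fun _ ↦ zero_le_one,
    fun i ↦ ?_, fun _ ↦ rfl, hcard, fun g hg ↦ ?_, fun z hz ↦ ?_, fun r hr hsep ↦ ?_, fun z w hz hw ↦ ?_⟩
  · -- zeros of `F` off `v`
    have hi : G (b i.1)⁻¹ = 0 := hzero i.1 i.2
    have hne : v + (b i.1)⁻¹ ≠ v := by
      intro e
      have : (b i.1)⁻¹ = 0 := by simpa using e
      exact i.2 (inv_eq_zero.1 this)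
    refine ⟨?_, hne⟩
    have hi' : h (v + (b i.1)⁻¹) = 0 := by simpa [hGdef, add_comm] using hi
    have := sub_smul_dslope F v (v + (b i.1)⁻¹)
    rw [hv, sub_zero, ← hh, hi', smul_zero] at this
    exact this.symm
  · -- fiber formula with multiplicities
    have h1 : (fun i : {n : ℕ // b n ≠ 0} ↦ (1 : ℝ) * g (v + (b i.1)⁻¹)) =
        fun i ↦ g (v + (b i.1)⁻¹) := by
      funext i
      rw [one_mul]
    rw [h1] at hg ⊢
    have h2 := hasSum_fiber_ncard (fun i : {n : ℕ // b n ≠ 0} ↦ v + (b i.1)⁻¹) g hg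
    have hfun : (fun c : ℂ ↦ (({i : {n : ℕ // b n ≠ 0} | v + (b i.1)⁻¹ = c} : Set _).ncard : ℝ) * g c) =
        fun c ↦ (analyticOrderNatAt h c : ℝ) * g c := by
      funext c
      rw [hcard c]
    rw [hfun] at h2
    exact h2
  · -- every zero of `h` is listed
    have hzv : z ≠ v := by intro e; rw [e] at hz; exact hhv hz
    have hGz : G (z - v) = 0 := by simpa [hGdef] using hz
    have hpos := analyticOrderNatAt_pos_of_zero hGd hG0 hGz
    have hzv' : z - v ≠ 0 := sub_ne_zero.2 hzv
    have hcard : {n : ℕ | b n = (z - v)⁻¹}.ncard ≠ 0 := by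
      rw [hmult (z - v) hzv']
      exact Nat.pos_iff_ne_zero.1 hpos
    obtain ⟨n, hn⟩ := Set.nonempty_of_ncard_ne_zero hcard
    have hbn : b n ≠ 0 := by
      rw [Set.mem_setOf_eq] at hn
      rw [hn]; exact inv_ne_zero hzv'
    refine ⟨⟨n, hbn⟩, ?_, zero_lt_one⟩
    simp only [Set.mem_setOf_eq] at hn
    simp only [hn, inv_inv]
    ring
  · -- the END-series summability, from `Σ ‖b n‖² < ∞`
    have hnorm : ∀ n : ℕ, ‖v - (v + (b n)⁻¹)‖ = ‖(b n)⁻¹‖ := by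
      intro n
      rw [← norm_neg]
      congr 1
      ring
    have hsep' : ∀ n, b n ≠ 0 → r < ‖(b n)⁻¹‖ := fun n hn ↦ by
      simpa [hnorm n] using hsep ⟨n, hn⟩
    have hS := (summable_end_majorant b hb hr hsep').subtype {n : ℕ | b n ≠ 0}
    refine hS.congr fun i ↦ ?_
    have hb0 : b i.1 ≠ 0 := i.2
    simp only [Function.comp_apply, hb0, if_false, hnorm]
  · -- the two-point bound, transported from `G`
    have hGz : G (z - v) ≠ 0 := by simpa [hGdef] using hz
    have hGw : G (w - v) ≠ 0 := by simpa [hGdef] using hw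
    have hmain := norm_logDeriv_sub_logDeriv_le hG0 hb hprod hGz hGw (hGd _) (hGd _)
    -- `logDeriv G x = h'/h (x + v)`
    have hlogG : ∀ x : ℂ, logDeriv G x = deriv h (x + v) / h (x + v) := by
      intro x
      rw [logDeriv_apply, hGdef]
      simp only [deriv_comp_add_const]
    rw [hlogG, hlogG] at hmain
    simp only [sub_add_cancel] at hmain
    -- the ℕ-indexed majorant and its restriction to the genuine zeros
    set g : ℕ → ℝ := fun n ↦ ‖b n‖ ^ 2 / (‖1 - b n * (z - v)‖ * ‖1 - b n * (w - v)‖) with hgdef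
    have hgs : Summable g := summable_twoPoint_terms hb (z - v) (w - v)
    have hsupp : Function.support g ⊆ {n : ℕ | b n ≠ 0} := by
      intro n hn
      simp only [Function.mem_support, ne_eq, hgdef] at hn
      intro hb0
      apply hn
      simp [hb0]
    have hgi : ∀ i : {n : ℕ // b n ≠ 0},
        g i.1 = 1 / (‖z - (v + (b i.1)⁻¹)‖ * ‖w - (v + (b i.1)⁻¹)‖) := by
      intro i
      have hb0 : b i.1 ≠ 0 := i.2
      have e1 : ∀ u : ℂ, ‖1 - b i.1 * (u - v)‖ = ‖b i.1‖ * ‖u - (v + (b i.1)⁻¹)‖ := by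
        intro u
        rw [← norm_mul, ← norm_neg (b i.1 * _)]
        congr 1
        field_simp
        ring
      simp only [hgdef, e1]
      have hbpos : 0 < ‖b i.1‖ := norm_pos_iff.2 hb0
      field_simp
    have hsum_eq : ∑' i : {n : ℕ // b n ≠ 0}, (1 : ℝ) / (‖z - (v + (b i.1)⁻¹)‖ * ‖w - (v + (b i.1)⁻¹)‖)
        = ∑' n, g n := by
      rw [← tsum_subtype_eq_of_support_subset hsupp]
      exact tsum_congr fun i ↦ (hgi i).symm
    have hsumm : Summable fun i : {n : ℕ // b n ≠ 0} ↦
        (1 : ℝ) / (‖z - (v + (b i.1)⁻¹)‖ * ‖w - (v + (b i.1)⁻¹)‖) := by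
      have := hgs.subtype {n : ℕ | b n ≠ 0}
      refine this.congr fun i ↦ ?_
      exact hgi i
    refine ⟨hsumm, ?_⟩
    rw [hsum_eq]
    have hzw : ‖z - v - (w - v)‖ = ‖z - w‖ := by congr 1; ring
    rw [hzw] at hmain
    exact hmain

end GenusOneLogDerivC3g41

end Literature.Analysis.Complex
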